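import Summits.Ventures.PercRepro.RLSRuleTwoLinesAnyGeom
import Summits.Ventures.PercRepro.RLSRuleTwoLines
import Summits.Ventures.PercRepro.RLSZeroWorld3
import Summits.Ventures.PercRepro.RLSRuleLineFreeArith

/-!
# PercRepro — `R₃⁺` at `t = 0` on EVERY plane with exactly two `3`-point lines, every `p ≥ 8` (night-3, gen 3)

The third infinite family of the `t = 0, P₂` half of the lane: on a plane with exactly two `3`-point lines `ℓ`, `ℓ′`
(`TwoLinesAny`, any size), every rank-`3` subset `B′` pays `Φ(p, 3)` by itself —

* no line inside `B′`: the triple share, total `Φ`;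
* exactly one line inside `B′`: `|B′| = 4` → `3 (z₁ − lost₄) ≥ Φ` (`sum_good_four_ge`), `|B′| = 5` → `ρ₃ = 9 ≥ 8`,
  `8 (z₂ − lost₅) ≥ Φ` (`sum_good_five_ge`), `|B′| ≥ 6` → share `1` on the good witnesses, `≥ l2aSum ≥ Φ`
  (`card_not_subset_ge`);
* both lines inside `B′`: `|B′| = 5` → `ρ₃ = 8`, `8 (z₂ − 2 lost₅) ≥ Φ` (`sum_good_both_ge`, `U0.zero_l3five2`);
  `|B′| ≥ 6` → share `1` on the witnesses containing neither coplanar triple, `≥ l2aSum − lostSum ≥ Φ`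
  (`card_not_subset_both_ge`, `U0.zero_l2a2` — the lane's generator, spec `l2a2`);
and the demand is at most `2^g − 3 − g − C(g, 2)` (`card_UqG_le_of_twoLinesAny`).

* **`perFlat_twoLinesAny`** — `Φ(p, 3) · #U_G ≤ Σ_{S ∈ Yq} w⁺(G, S)` for every `TwoLinesAny` plane of type `0`
  and every `p ≥ 8`.  With `perFlat_lineFree` and `perFlat_oneLine`: the per-flat inequality of `R₃⁺` at `t = 0`
  is a kernel theorem on every plane with AT MOST TWO `3`-point lines (and no `4`-point line), every `p ≥ 8`.
Imports `RLSRuleTwoLinesAnyGeom`, `RLSRuleTwoLines`, `RLSZeroWorld3`, `RLSRuleLineFreeArith`.  Axioms: standard.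
-/

open scoped Matroid

namespace PercRepro

namespace NightThree

open Finset ThmH PerFlat

variable {α : Type*} [DecidableEq α] {M : Matroid α} [M.Finite]

/-- `#{X ∈ W : C ⊄ X} ≥ l2aSum n` (the witnesses with at most one point of `C`). -/
theorem l2aSum_le_card_not_subset {K C : Finset α} {n : ℕ} (hK : K.card = n + 4) (hC : C ⊆ K)
    (hCc : C.card = 3) :
    U0.l2aSum n ≤ (((witnessFamily K n).filter (fun X => ¬ C ⊆ X)).card : ℚ) := by
  classical
  unfold U0.l2aSum
  unfold witnessFamily
  rw [Finset.filter_biUnion, Finset.card_biUnion (fun x _ y _ h => by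
    exact Finset.disjoint_filter_filter (K.pairwise_disjoint_powersetCard h))]
  rw [Nat.cast_sum, Finset.sum_Ico_eq_sum_range, show n + 1 - 1 = n from rfl]
  apply Finset.sum_le_sum
  intro i _
  have h := card_powersetCard_not_subset_ge hC hCc (x := 1 + i) (by omega)
  rw [hK, show n + 4 - 3 = n + 1 by omega, show 1 + i - 1 = i by omega] at h
  rw [add_comm 1 i] at h ⊢
  exact_mod_cast h

/-- `#{X ∈ W : C′ ⊆ X} = lostSum n`. -/
theorem card_filter_subset_eq_lostSum {K C' : Finset α} {n : ℕ} (hn : 2 ≤ n) (hK : K.card = n + 4)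
    (hC' : C' ⊆ K) (hC'c : C'.card = 3) :
    (((witnessFamily K n).filter (fun X => C' ⊆ X)).card : ℚ) = U0.lostSum n := by
  classical
  have h := sum_filter_subset_witnessFamily hn hK hC' hC'c (fun _ => (1 : ℚ))
  rw [Finset.sum_const, nsmul_eq_mul, mul_one] at h
  rw [h]
  unfold U0.lostSum
  apply Finset.sum_congr rfl
  intro j _
  ring

/-- **Both lines, `≥ 6` points**: the witnesses containing neither coplanar triple number at least `Φ(p, 3)`. -/
theorem card_not_subset_both_ge {K C C' : Finset α} {n : ℕ} (hn : 4 ≤ n) (hK : K.card = n + 4) (hC : C ⊆ K)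
    (hCc : C.card = 3) (hC' : C' ⊆ K) (hC'c : C'.card = 3) :
    phiK (n + 4) 3 ≤ (((witnessFamily K n).filter (fun X => ¬ C ⊆ X ∧ ¬ C' ⊆ X)).card : ℚ) := by
  classical
  have hkey := U0.zero_l2a2 n hn
  have hphi : phiK (n + 4) 3 = ∑ i ∈ range n, ((n + 4).choose (i + 1) : ℚ) / ((i + 4).choose 3 : ℚ) := by
    unfold phiK
    rw [phiW_eq_phiK_form n]
    rfl
  rw [← hphi] at hkey
  have h1 := l2aSum_le_card_not_subset hK hC hCc
  have h2 := card_filter_subset_eq_lostSum (by omega) hK hC' hC'c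
  -- `{¬C} ∖ {C′ ⊆ X} ⊆ {¬C ∧ ¬C′}`
  have hsub : (witnessFamily K n).filter (fun X => ¬ C ⊆ X) \ (witnessFamily K n).filter (fun X => C' ⊆ X) ⊆
      (witnessFamily K n).filter (fun X => ¬ C ⊆ X ∧ ¬ C' ⊆ X) := by
    intro X hX
    rw [Finset.mem_sdiff, Finset.mem_filter, Finset.mem_filter] at hX
    rw [Finset.mem_filter]
    exact ⟨hX.1.1, hX.1.2, fun h => hX.2 ⟨hX.1.1, h⟩⟩
  have h3 := Finset.card_le_card hsub
  have h4 := Finset.le_card_sdiff ((witnessFamily K n).filter (fun X => C' ⊆ X))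
    ((witnessFamily K n).filter (fun X => ¬ C ⊆ X))
  have h5 : (((witnessFamily K n).filter (fun X => ¬ C ⊆ X)).card : ℚ) -
      (((witnessFamily K n).filter (fun X => C' ⊆ X)).card : ℚ) ≤
      (((witnessFamily K n).filter (fun X => ¬ C ⊆ X ∧ ¬ C' ⊆ X)).card : ℚ) := by
    have := h4.trans h3
    have h6 : ((((witnessFamily K n).filter (fun X => ¬ C ⊆ X)).card -
        ((witnessFamily K n).filter (fun X => C' ⊆ X)).card : ℕ) : ℚ) ≤
        (((witnessFamily K n).filter (fun X => ¬ C ⊆ X ∧ ¬ C' ⊆ X)).card : ℚ) := by exact_mod_cast this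
    have h7 : (((witnessFamily K n).filter (fun X => ¬ C ⊆ X)).card : ℚ) -
        (((witnessFamily K n).filter (fun X => C' ⊆ X)).card : ℚ) ≤
        ((((witnessFamily K n).filter (fun X => ¬ C ⊆ X)).card -
          ((witnessFamily K n).filter (fun X => C' ⊆ X)).card : ℕ) : ℚ) := by
      rcases le_or_gt (((witnessFamily K n).filter (fun X => C' ⊆ X)).card)
          (((witnessFamily K n).filter (fun X => ¬ C ⊆ X)).card) with hle | hlt
      · rw [Nat.cast_sub hle]
      · rw [Nat.sub_eq_zero_of_le hlt.le, Nat.cast_zero]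
        have : (((witnessFamily K n).filter (fun X => ¬ C ⊆ X)).card : ℚ) <
            (((witnessFamily K n).filter (fun X => C' ⊆ X)).card : ℚ) := by exact_mod_cast hlt
        linarith
    exact h7.trans h6
  rw [h2] at h5
  linarith

/-- The demand of a `TwoLinesAny` plane: at most `Σ_{b ≥ 3} C(g, b) − 2`. -/
theorem card_UqG_le_of_twoLinesAny {G ℓ ℓ' : Finset α} (h : TwoLinesAny M G ℓ ℓ') (p : ℕ) :
    ((UqG M p 3 G).card : ℚ) ≤ demandCount G.card 0 - 2 := by
  classical
  obtain ⟨hℓG, hℓ'G, hℓc, hℓ'c, hℓr, hℓ'r, hne, _, _⟩ := h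
  set F := G.powerset.filter (fun B => 3 ≤ B.card) with hF
  have hsub : UqG M p 3 G ⊆ (F.erase ℓ).erase ℓ' := by
    intro B hB
    unfold UqG at hB
    rw [Finset.mem_filter, mem_Uq] at hB
    obtain ⟨⟨_, hB3, _⟩, hBG⟩ := hB
    have hB3' : M.eRk (B : Set α) = 3 := by exact_mod_cast hB3
    rw [Finset.mem_erase, Finset.mem_erase, hF, Finset.mem_filter, Finset.mem_powerset]
    refine ⟨?_, ?_, hBG, three_le_card_of_eRk_eq_three hB3'⟩
    · rintro rfl; rw [hℓ'r] at hB3'; exact absurd hB3' (by norm_num)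
    · rintro rfl; rw [hℓr] at hB3'; exact absurd hB3' (by norm_num)
  have hcard : (F.card : ℚ) = demandCount G.card 0 := by
    unfold demandCount
    rw [hF, Finset.card_filter, Nat.cast_sum,
      Finset.sum_powerset_apply_card (fun b => ((if 3 ≤ b then 1 else 0 : ℕ) : ℚ))]
    apply Finset.sum_congr rfl
    intro b hb
    rw [Finset.mem_range] at hb
    rw [nsmul_eq_mul]
    congr 1
    by_cases h3 : 3 ≤ b
    · rw [if_pos h3, if_pos ⟨h3, by omega⟩]; rfl
    · rw [if_neg h3, if_neg (fun h => h3 h.1)]; rfl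
  have hmemℓ : ℓ ∈ F := by rw [hF, Finset.mem_filter, Finset.mem_powerset]; exact ⟨hℓG, by omega⟩
  have hmemℓ' : ℓ' ∈ F.erase ℓ := by
    rw [Finset.mem_erase, hF, Finset.mem_filter, Finset.mem_powerset]; exact ⟨hne.symm, hℓ'G, by omega⟩
  have h1 := Finset.card_le_card hsub
  rw [Finset.card_erase_of_mem hmemℓ', Finset.card_erase_of_mem hmemℓ] at h1
  have hpos : 2 ≤ F.card := by
    have := Finset.card_pos.2 ⟨ℓ', hmemℓ'⟩
    rw [Finset.card_erase_of_mem hmemℓ] at this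
    omega
  have h2 : ((UqG M p 3 G).card : ℚ) ≤ (F.card : ℚ) - 2 := by
    have : (UqG M p 3 G).card + 2 ≤ F.card := by omega
    have := (Nat.cast_le (α := ℚ)).2 this
    push_cast at this
    linarith
  rw [hcard] at h2
  exact h2

open scoped Classical in
/-- **`R₃⁺` at `t = 0` on every plane with exactly two `3`-point lines**, every `p ≥ 8`. -/
theorem perFlat_twoLinesAny {G ℓ ℓ' : Finset α} (hG : G ∈ flatsQ M 3) (h : TwoLinesAny M G ℓ ℓ') {n : ℕ}
    (hn : 4 ≤ n) (hK : ((n + 4 : ℕ) : ℕ∞) ≤ M.eRk ((gr M \ G : Finset α) : Set α)) :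
    phiK (n + 4) 3 * ((UqG M (n + 4) 3 G).card : ℚ) ≤ ∑ S ∈ Yq M (n + 4) 3, wPlus M G S := by
  obtain ⟨K, hKsub, hKind, hKcard⟩ := exists_indep_compl_card G hK
  have hKG : Disjoint K G := by
    rw [Finset.disjoint_left]
    intro x hxK hxG
    have := hKsub hxK
    rw [Finset.mem_sdiff] at this
    exact this.2 hxG
  obtain ⟨hℓG, hℓ'G, hℓc, hℓ'c, hℓr, hℓ'r, hne, hsimple, hind⟩ := h
  have h' : TwoLinesAny M G ℓ ℓ' := ⟨hℓG, hℓ'G, hℓc, hℓ'c, hℓr, hℓ'r, hne, hsimple, hind⟩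
  have hunion := card_union_bounds' hG h'
  obtain ⟨C, hCK, hCc, hgoodC⟩ := exists_good_triple hG hℓG hℓr hKsub hKind (by omega)
  obtain ⟨C', hC'K, hC'c, hgoodC'⟩ := exists_good_triple hG hℓ'G hℓ'r hKsub hKind (by omega)
  -- the family of rank-`3` subsets
  set 𝔅 : Finset (Finset α) := ((G.powerset.filter (fun B => 3 ≤ B.card)).erase ℓ).erase ℓ' with h𝔅
  have h𝔅mem : ∀ B ∈ 𝔅, B ⊆ G ∧ 3 ≤ B.card ∧ B ≠ ℓ ∧ B ≠ ℓ' := by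
    intro B hB
    rw [h𝔅, Finset.mem_erase, Finset.mem_erase, Finset.mem_filter, Finset.mem_powerset] at hB
    exact ⟨hB.2.2.1, hB.2.2.2, hB.2.1, hB.1⟩
  have h𝔅rank : ∀ B ∈ 𝔅, B ⊆ G ∧ M.eRk (B : Set α) = 3 := by
    intro B hB
    obtain ⟨hBG, hBc, hBℓ, hBℓ'⟩ := h𝔅mem B hB
    refine ⟨hBG, ?_⟩
    apply le_antisymm
    · rw [← eRk_eq_three_of_mem_flatsQ' hG]; exact M.eRk_mono (Finset.coe_subset.2 hBG)
    · obtain ⟨T, hTB, hTc, hTind⟩ : ∃ T ⊆ B, T.card = 3 ∧ M.Indep (T : Set α) := by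
        rcases Nat.lt_or_ge B.card 4 with h3 | h4
        · have hBc3 : B.card = 3 := by omega
          exact ⟨B, le_rfl, hBc3, hind B (Finset.mem_powersetCard.2 ⟨hBG, hBc3⟩) hBℓ hBℓ'⟩
        · obtain ⟨L, hLB, hLc⟩ := Finset.exists_subset_card_eq h4
          obtain ⟨T, hTL, hTc, hTind⟩ := exists_indep_triple_of_four' h' (hLB.trans hBG) hLc
          exact ⟨T, hTL.trans hLB, hTc, hTind⟩
      rw [← eRk_eq_three_of_indep_card hTind hTc]
      exact M.eRk_mono (Finset.coe_subset.2 hTB)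
  have h𝔅card : (𝔅.card : ℚ) = demandCount G.card 0 - 2 := by
    set F := G.powerset.filter (fun B => 3 ≤ B.card) with hF
    have hcard : (F.card : ℚ) = demandCount G.card 0 := by
      unfold demandCount
      rw [hF, Finset.card_filter, Nat.cast_sum,
        Finset.sum_powerset_apply_card (fun b => ((if 3 ≤ b then 1 else 0 : ℕ) : ℚ))]
      apply Finset.sum_congr rfl
      intro b hb
      rw [Finset.mem_range] at hb
      rw [nsmul_eq_mul]
      congr 1
      by_cases h3 : 3 ≤ b
      · rw [if_pos h3, if_pos ⟨h3, by omega⟩]; rfl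
      · rw [if_neg h3, if_neg (fun h => h3 h.1)]; rfl
    have hmemℓ : ℓ ∈ F := by rw [hF, Finset.mem_filter, Finset.mem_powerset]; exact ⟨hℓG, by omega⟩
    have hmemℓ' : ℓ' ∈ F.erase ℓ := by
      rw [Finset.mem_erase, hF, Finset.mem_filter, Finset.mem_powerset]; exact ⟨hne.symm, hℓ'G, by omega⟩
    have hpos : 2 ≤ F.card := by
      have := Finset.card_pos.2 ⟨ℓ', hmemℓ'⟩
      rw [Finset.card_erase_of_mem hmemℓ] at this
      omega
    rw [h𝔅, Finset.card_erase_of_mem hmemℓ', Finset.card_erase_of_mem hmemℓ, Nat.cast_sub (by omega),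
      Nat.cast_sub (by omega), hcard]
    push_cast
    ring
  -- the share bound per subset
  set f : Finset α → Finset α → ℚ := fun B X =>
    if ℓ ⊆ B ∨ ℓ' ⊆ B then
      (if (ℓ ⊆ B → ¬ C ⊆ X) ∧ (ℓ' ⊆ B → ¬ C' ⊆ X) then
        (if B.card = 4 then 3 / (((4 + X.card).choose 3 : ℕ) : ℚ)
          else if B.card = 5 then 8 / (((5 + X.card).choose 3 : ℕ) : ℚ) else 1)
        else 0)
    else 1 / (((3 + X.card).choose 3 : ℕ) : ℚ) with hf
  have hfour : ∀ B ∈ 𝔅, (ℓ ⊆ B ∨ ℓ' ⊆ B) → 4 ≤ B.card := by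
    intro B hB hline
    obtain ⟨_, hBc, hBℓ, hBℓ'⟩ := h𝔅mem B hB
    by_contra hc
    push Not at hc
    rcases hline with hl | hl
    · exact hBℓ (Finset.eq_of_subset_of_card_le hl (by omega)).symm
    · exact hBℓ' (Finset.eq_of_subset_of_card_le hl (by omega)).symm
  have hnotboth4 : ∀ B, B.card = 4 → ¬ (ℓ ⊆ B ∧ ℓ' ⊆ B) := by
    rintro B h4 ⟨hl, hl'⟩
    have := Finset.card_le_card (Finset.union_subset hl hl')
    omega
  have hsup := supply_ge_of_family hG h𝔅rank hKsub hKind n f (fun B hB X hX => by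
    obtain ⟨hBG, hBc, hBℓ, hBℓ'⟩ := h𝔅mem B hB
    obtain ⟨hXK, _, _⟩ := mem_witnessFamily hX
    have hXind : M.Indep (X : Set α) := hKind.subset (Finset.coe_subset.2 hXK)
    have hXG : Disjoint X G := Finset.disjoint_of_subset_left hXK hKG
    rw [hf]
    dsimp only
    by_cases hline : ℓ ⊆ B ∨ ℓ' ⊆ B
    · rw [if_pos hline]
      by_cases hgd : (ℓ ⊆ B → ¬ C ⊆ X) ∧ (ℓ' ⊆ B → ¬ C' ⊆ X)
      · rw [if_pos hgd]
        have hw := wPlus_ge_of_twoLines' hG h' hBG hXind hXG hXK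
          ⟨fun hl => hgoodC X (hgd.1 hl), fun hl => hgoodC' X (hgd.2 hl)⟩
        refine le_trans ?_ hw
        have hB4 := hfour B hB hline
        by_cases h4 : B.card = 4
        · rw [if_pos h4]
          rw [if_pos (show B.card ≤ 5 by omega), h4]
          have hrho : ((4 : ℕ).choose 3 - (if ℓ ⊆ B then 1 else 0) - (if ℓ' ⊆ B then 1 else 0) : ℕ) = 3 := by
            rcases hline with hl | hl
            · rw [if_pos hl, if_neg (fun hl' => hnotboth4 B h4 ⟨hl, hl'⟩)]; norm_num [Nat.choose]
            · rw [if_neg (fun hl' => hnotboth4 B h4 ⟨hl', hl⟩), if_pos hl]; norm_num [Nat.choose]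
          rw [hrho]
          norm_num
        · rw [if_neg h4]
          by_cases h5 : B.card = 5
          · rw [if_pos h5, if_pos (show B.card ≤ 5 by omega), h5]
            -- `ρ₃ ∈ {8, 9} ≥ 8`
            have hge : (8 : ℕ) ≤ (5 : ℕ).choose 3 - (if ℓ ⊆ B then 1 else 0) - (if ℓ' ⊆ B then 1 else 0) := by
              split_ifs <;> norm_num [Nat.choose]
            have hpos : (0 : ℚ) < (((5 + X.card).choose 3 : ℕ) : ℚ) := by
              exact_mod_cast Nat.choose_pos (by omega : 3 ≤ 5 + X.card)
            rw [div_le_div_iff_of_pos_right hpos]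
            exact_mod_cast hge
          · rw [if_neg h5, if_neg (show ¬ B.card ≤ 5 by omega)]
      · rw [if_neg hgd]
        exact wPlus_nonneg M G (B ∪ X)
    · rw [if_neg hline]
      push Not at hline
      have hw := wPlus_ge_of_twoLines' hG h' hBG hXind hXG hXK
        ⟨fun hl => absurd hl hline.1, fun hl => absurd hl hline.2⟩
      refine le_trans ?_ hw
      rcases le_or_gt B.card 5 with h5 | h6
      · rw [if_pos h5, if_neg hline.1, if_neg hline.2, Nat.sub_zero, Nat.sub_zero]
        obtain ⟨m, hm⟩ : ∃ m, B.card = m + 3 := ⟨B.card - 3, by omega⟩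
        rw [hm, div_le_div_iff₀ (by exact_mod_cast Nat.choose_pos (by omega : 3 ≤ 3 + X.card))
          (by exact_mod_cast Nat.choose_pos (by omega : 3 ≤ m + 3 + X.card)), one_mul, add_comm 3 X.card]
        exact choose_three_mul_choose_three_ge m X.card
      · rw [if_neg (show ¬ B.card ≤ 5 by omega)]
        rw [div_le_one (by exact_mod_cast Nat.choose_pos (by omega : 3 ≤ 3 + X.card))]
        exact_mod_cast Nat.choose_pos (by omega : 3 ≤ 3 + X.card))
  -- every subset pays `Φ`
  have hpay : ∀ B ∈ 𝔅, phiK (n + 4) 3 ≤ ∑ X ∈ witnessFamily K n, f B X := by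
    intro B hB
    obtain ⟨hBG, hBc, hBℓ, hBℓ'⟩ := h𝔅mem B hB
    by_cases hline : ℓ ⊆ B ∨ ℓ' ⊆ B
    · have hB4 := hfour B hB hline
      have hnonneg : ∀ X ∈ witnessFamily K n, 0 ≤ f B X := by
        intro X _
        rw [hf]
        dsimp only
        split_ifs <;> positivity
      -- the value of `f` on a good witness
      have hval : ∀ X, ((ℓ ⊆ B → ¬ C ⊆ X) ∧ (ℓ' ⊆ B → ¬ C' ⊆ X)) →
          (if B.card = 4 then 3 / (((4 + X.card).choose 3 : ℕ) : ℚ)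
            else if B.card = 5 then 8 / (((5 + X.card).choose 3 : ℕ) : ℚ) else 1) ≤ f B X := by
        intro X hgd
        rw [hf]
        dsimp only
        rw [if_pos hline, if_pos hgd]
      by_cases hboth : ℓ ⊆ B ∧ ℓ' ⊆ B
      · -- both lines: `|B′| ≥ 5`
        have hB5 : 5 ≤ B.card := by
          have := Finset.card_le_card (Finset.union_subset hboth.1 hboth.2)
          omega
        have hgd : ∀ X ∈ (witnessFamily K n).filter (fun X => ¬ C ⊆ X ∧ ¬ C' ⊆ X),
            (ℓ ⊆ B → ¬ C ⊆ X) ∧ (ℓ' ⊆ B → ¬ C' ⊆ X) := by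
          intro X hX
          rw [Finset.mem_filter] at hX
          exact ⟨fun _ => hX.2.1, fun _ => hX.2.2⟩
        by_cases h5 : B.card = 5
        · calc phiK (n + 4) 3 ≤ ∑ X ∈ (witnessFamily K n).filter (fun X => ¬ C ⊆ X ∧ ¬ C' ⊆ X),
                8 / (((5 + X.card).choose 3 : ℕ) : ℚ) := sum_good_both_ge hn hKcard hCK hCc hC'K hC'c
            _ ≤ ∑ X ∈ (witnessFamily K n).filter (fun X => ¬ C ⊆ X ∧ ¬ C' ⊆ X), f B X := by
                apply Finset.sum_le_sum
                intro X hX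
                refine le_trans (le_of_eq ?_) (hval X (hgd X hX))
                rw [if_neg (by omega), if_pos h5]
            _ ≤ ∑ X ∈ witnessFamily K n, f B X :=
                Finset.sum_le_sum_of_subset_of_nonneg (Finset.filter_subset _ _) (fun X hX _ => hnonneg X hX)
        · calc phiK (n + 4) 3 ≤ (((witnessFamily K n).filter (fun X => ¬ C ⊆ X ∧ ¬ C' ⊆ X)).card : ℚ) :=
                card_not_subset_both_ge hn hKcard hCK hCc hC'K hC'c
            _ = ∑ X ∈ (witnessFamily K n).filter (fun X => ¬ C ⊆ X ∧ ¬ C' ⊆ X), (1 : ℚ) := by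
                rw [Finset.sum_const, nsmul_eq_mul, mul_one]
            _ ≤ ∑ X ∈ (witnessFamily K n).filter (fun X => ¬ C ⊆ X ∧ ¬ C' ⊆ X), f B X := by
                apply Finset.sum_le_sum
                intro X hX
                refine le_trans (le_of_eq ?_) (hval X (hgd X hX))
                rw [if_neg (by omega), if_neg h5]
            _ ≤ ∑ X ∈ witnessFamily K n, f B X :=
                Finset.sum_le_sum_of_subset_of_nonneg (Finset.filter_subset _ _) (fun X hX _ => hnonneg X hX)
      · -- exactly one line: its triple `D`
        obtain ⟨D, hDK, hDc, hgdD⟩ : ∃ D ⊆ K, D.card = 3 ∧ ∀ X, ¬ D ⊆ X →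
            ((ℓ ⊆ B → ¬ C ⊆ X) ∧ (ℓ' ⊆ B → ¬ C' ⊆ X)) := by
          rcases hline with hl | hl
          · exact ⟨C, hCK, hCc, fun X hX => ⟨fun _ => hX, fun hl' => absurd ⟨hl, hl'⟩ hboth⟩⟩
          · exact ⟨C', hC'K, hC'c, fun X hX => ⟨fun hl' => absurd ⟨hl', hl⟩ hboth, fun _ => hX⟩⟩
        have hgd : ∀ X ∈ (witnessFamily K n).filter (fun X => ¬ D ⊆ X),
            (ℓ ⊆ B → ¬ C ⊆ X) ∧ (ℓ' ⊆ B → ¬ C' ⊆ X) := by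
          intro X hX
          rw [Finset.mem_filter] at hX
          exact hgdD X hX.2
        by_cases h4 : B.card = 4
        · calc phiK (n + 4) 3 ≤ ∑ X ∈ (witnessFamily K n).filter (fun X => ¬ D ⊆ X),
                3 / (((4 + X.card).choose 3 : ℕ) : ℚ) := sum_good_four_ge hn hKcard hDK hDc
            _ ≤ ∑ X ∈ (witnessFamily K n).filter (fun X => ¬ D ⊆ X), f B X := by
                apply Finset.sum_le_sum
                intro X hX
                refine le_trans (le_of_eq ?_) (hval X (hgd X hX))
                rw [if_pos h4]
            _ ≤ ∑ X ∈ witnessFamily K n, f B X :=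
                Finset.sum_le_sum_of_subset_of_nonneg (Finset.filter_subset _ _) (fun X hX _ => hnonneg X hX)
        · by_cases h5 : B.card = 5
          · calc phiK (n + 4) 3 ≤ ∑ X ∈ (witnessFamily K n).filter (fun X => ¬ D ⊆ X),
                  8 / (((5 + X.card).choose 3 : ℕ) : ℚ) := sum_good_five_ge hn hKcard hDK hDc
              _ ≤ ∑ X ∈ (witnessFamily K n).filter (fun X => ¬ D ⊆ X), f B X := by
                  apply Finset.sum_le_sum
                  intro X hX
                  refine le_trans (le_of_eq ?_) (hval X (hgd X hX))
                  rw [if_neg h4, if_pos h5]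
              _ ≤ ∑ X ∈ witnessFamily K n, f B X :=
                  Finset.sum_le_sum_of_subset_of_nonneg (Finset.filter_subset _ _) (fun X hX _ => hnonneg X hX)
          · calc phiK (n + 4) 3 ≤ (((witnessFamily K n).filter (fun X => ¬ D ⊆ X)).card : ℚ) :=
                  card_not_subset_ge hn hKcard hDK hDc
              _ = ∑ X ∈ (witnessFamily K n).filter (fun X => ¬ D ⊆ X), (1 : ℚ) := by
                  rw [Finset.sum_const, nsmul_eq_mul, mul_one]
              _ ≤ ∑ X ∈ (witnessFamily K n).filter (fun X => ¬ D ⊆ X), f B X := by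
                  apply Finset.sum_le_sum
                  intro X hX
                  refine le_trans (le_of_eq ?_) (hval X (hgd X hX))
                  rw [if_neg h4, if_neg h5]
              _ ≤ ∑ X ∈ witnessFamily K n, f B X :=
                  Finset.sum_le_sum_of_subset_of_nonneg (Finset.filter_subset _ _) (fun X hX _ => hnonneg X hX)
    · have hval : ∀ X ∈ witnessFamily K n, f B X = 1 / (((3 + X.card).choose 3 : ℕ) : ℚ) := by
        intro X _
        rw [hf]
        dsimp only
        rw [if_neg hline]
      rw [Finset.sum_congr rfl hval, sum_witness_eq_phiK hKcard]
  have hdem := card_UqG_le_of_twoLinesAny h' (n + 4)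
  calc phiK (n + 4) 3 * ((UqG M (n + 4) 3 G).card : ℚ)
      ≤ phiK (n + 4) 3 * (demandCount G.card 0 - 2) := mul_le_mul_of_nonneg_left hdem (phiK_nonneg _ _)
    _ = ∑ B ∈ 𝔅, phiK (n + 4) 3 := by rw [Finset.sum_const, nsmul_eq_mul, h𝔅card, mul_comm]
    _ ≤ ∑ B ∈ 𝔅, ∑ X ∈ witnessFamily K n, f B X := Finset.sum_le_sum hpay
    _ ≤ ∑ S ∈ Yq M (n + 4) 3, wPlus M G S := hsup

end NightThree

end PercRepro
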